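import Summits.BirchSwinnertonDyer.BirchSwinnertonDyer.Theorems.ByReductionTypeAtTwoOrdKatoReserveDefs
import Summits.BirchSwinnertonDyer.BirchSwinnertonDyer.Theorems.ByReductionTypeAtTwoOrdKatoIntInstance28809c
import HarnessLib

/-!
# RESERVE-tier binder road, CLASS INSTANCE (demonstration of `ByReductionTypeAtTwoOrdKatoReserveDefs`):
# the X5 class **28809c** (`28809c1 = [1, −1, 0, −247335, −47373436]`, good ordinary at `2`, `E[2]`
# irreducible, `ρ_{E,2^∞}` onto, `Δ < 0`, `#Ш_an = 16`, `λ_an = 12`; NO tower class file) —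
# `BSD(28809c1, 2)` displaying ONLY the reserve-refereed binder `KatoReserveWK2AtGoodOrdSurjectiveTwo`
# (W_K2 Thm. B verbatim, review UPHELD 2026-08-07) + PRINT + ONE descent certificate; no cell-memo input
# (route ByReductionTypeAtTwo, crux `OrdKatoHalfAtTwoIso` 19573; seat bsd-2adic-ord GEN 9)

HONEST FRAMING (cell `bsd-2adic`, run/shared/lean/pub/bsd-2adic/): THEOREMS only (the curve's kernel data
is GEN 8's `…OrdKatoIntInstance28809c.lean`, p465370); nothing asserted; no named fact introduced; the
binder is DISPLAYED, not proved — under the cell's bar this row is NO-OFFER; closes nothing by itself; the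
`∀`-crux 19573 stays OPEN. Twin of `bsdp_two_28809c1_of_katoInt` (p465370) one tier down: at `Δ < 0`
W_K2 Theorem B IS the sharp Kato half, so the SAME displayed inputs {`hDD`, `hEC`, `hmod`, `hGZK`, `h17`,
`hr`, `hlow`} suffice with the reserve binder in place of the GEN-8 (reserve+memo) binder.
PARTITION: X5@2 good-ord (B1·O1), class 28809c × p = 2 — types-the-object-of (door-ready modulo a
RESERVE binder); closes none; nothing booked. bears_on: K4 (items 19573 / 19271).
References: [CremonaAlgorithms1997] Table 1 (28809c1); [DokchitserDokchitserMathZ2012] Theorem;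
[GreenbergLNM1716] Thm. 4.1; [Kato2004Asterisque] Thm. 17.4; [Miller2011LMS] Def. 1.1.
-/

set_option autoImplicit false
-- the sub-problem namespace repeats the summit name by design (D-0017 nested layout)
set_option linter.dupNamespace false

noncomputable section

open scoped Classical MatrixGroups ModularForm

open CongruenceSubgroup WeierstrassCurve Literature.NumberTheory.EllipticCurves
  Literature.NumberTheory.EllipticCurves.ModularForms Literature.NumberTheory.EllipticCurves.Rank1Residual
  Literature.NumberTheory.EllipticCurves.Rank1Residual.Typed
  Summit.BirchSwinnertonDyer.Rank1Residual.X5 Summit.BirchSwinnertonDyer.Rank1Residual.X5.O1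
  Summit.BirchSwinnertonDyer.Rank1Residual.X5.Instances

namespace Summit.BirchSwinnertonDyer.BirchSwinnertonDyer.Theorems.OrdKatoIntAtTwo

/-- `Δ(28809c1) < 0` (one real component, `c_∞ = 1`). [cite: CremonaAlgorithms1997, Table 1] -/
theorem c28809c1_Δ_neg : c28809c1.Δ < 0 := by
  rw [c28809c1_Δ]; norm_num

/-- **The Kato half AT `28809c1` from the RESERVE binder alone** (items 19573 / 19271 at this class
member): W_K2 Thm. B at `Δ < 0` is the item, the habitat being kernel-decided (Dokchitser–Dokchitser).
[cite: Kato2004Asterisque, Thm. 17.4 (p. 273) (shape)] [cite: DokchitserDokchitserMathZ2012, Theorem (p. 961)] -/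
theorem mainConjectureLowerDivisibilityAtTwoOrd_28809c1_of_katoReserve
    (hK : KatoReserveWK2AtGoodOrdSurjectiveTwo)
    (hDD : DokchitserDokchitser2012_surjective_mod_two_four_eight) :
    MainConjectureLowerDivisibilityAtTwoOrd c28809c1 :=
  mainConjectureLowerDivisibilityAtTwoOrd_of_katoReserveWK2_of_Δ_neg c28809c1 hK goodOrd_two_28809c1
    (twoAdicSurjective_28809c1 hDD) c28809c1_Δ_neg

/-- **`BSD(28809c1, 2)` on the RESERVE-tier binder road**: PRINT {`hEC`, `hmod`, `hGZK`, `h17`, `hDD`} +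
the reserve-refereed binder `hK` (W_K2 Thm. B) + `hr : r_an = 0` + ONE descent certificate
`hlow : ord₂ #Ш_an ≤ ord₂ #Ш` — no cell-memo binder, no layer count, no `λ`/`μ` certificate, no GRH, no
parity certificate (the `Δ < 0` door is sharp). [cite: Miller2011LMS, Def. 1.1 and §1]
[cite: GreenbergLNM1716, Thm. 4.1 (p. 102)] [cite: CremonaAlgorithms1997, Table 1] -/
theorem bsdp_two_28809c1_of_katoReserve (hK : KatoReserveWK2AtGoodOrdSurjectiveTwo)
    (hDD : DokchitserDokchitser2012_surjective_mod_two_four_eight)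
    (hEC : TwoAdicEulerCharRankZero c28809c1 0) (hmod : nonempty_modularParametrizationData)
    (hGZK : rank_eq_analyticRank_of_analyticRank_le_one)
    (h17 : ∀ [NeZero (c28809c1.conductorNorm ℤ)] (f : CuspForm (Gamma0 (c28809c1.conductorNorm ℤ)) 2),
      kato_divisibility_allPrimes c28809c1 2 (f := f))
    (hr : c28809c1.analyticRank = 0) (hlow : MissingLowerBoundAt c28809c1 2) : BSDp c28809c1 2 :=
  bsdp_two_of_katoReserveWK2_of_Δ_neg_of_missingLowerBoundAt c28809c1 hK hEC hmod hGZK h17 hr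
    goodOrd_two_28809c1 (twoAdicSurjective_28809c1 hDD) c28809c1_Δ_neg hlow

end Summit.BirchSwinnertonDyer.BirchSwinnertonDyer.Theorems.OrdKatoIntAtTwo

end
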